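import Summits.PneNP.PneNP.Theorems.KarlinRubinMonotoneBlindFormFubini
import Summits.PneNP.PneNP.Theorems.KarlinRubinMonotoneBlindPi3Planted

/-!
# Route KarlinRubin, crux `MonotoneBlind` (stmt-PneNP-18027): constant depth — the depth reduction along a random flag

Stage C of the AC⁰ line (seat write-up `MonotoneBlind_AC0_announce.md`): the induction on the depth. For a level-`(j+1)`
formula `f` with top gate AND (wrap an OR-top formula in a one-child AND), inside the universe `V` (`#V = m`), with
fan-ins `≤ M` and level-`0` sets of `≤ L` slots, and a list `ms = [m₁, …, m_j]` of sub-universe sizes: the average over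
the `k`-subsets `A ⊆ V` of `Pr_x[f(x ∨ K_A) ∧ ¬ f(x)]` is at most `swErr v₀ k m ms M L` (`swIter_avg_le`), where
(`r = C(v₀-1,2)`, `T(M,L) = 2^{2r}(2(L+1)^{2r})^{r+1} + M·C(2L,v₀)`)

  `swErr m [] M L = L k²/m²` (CNF revival),
  `swErr m (m₁ :: ms) M L = M^j T(M,L) m₁^{v₀}/m^{v₀} + swErr m₁ ms (M 2^r) r` (switch w.r.t. a uniform `m₁`-subset).

Step: choose `A` through a uniform `m₁`-subset `V₁ ⊇ A` (`sum_powersetCard_flag_le_of`); off the bad event of the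
switching (`swReduce_bad_count`) `f` agrees with its reduction, which depends on the input only off the inside of `V₁`
and reads only the inside (`exists_outside_max`), so the induction hypothesis applies to the worst outside part.

All `--supports stmt-PneNP-18027`; no definitions (`swSizeOK`, `swT`, `swErr` are in `…FormIterDefs`).
-/

set_option linter.dupNamespace false -- `Summit.PneNP.PneNP.…`: summit = sub-problem (D-0017)

namespace Summit.PneNP.PneNP.Theorems

open Finset
open scoped ENNReal
open Literature.Computability.Complexity
open Literature.Probability.RandomGraphs.PlantedClique

variable {n : ℕ}

/-! ### Choosing the planted set through a sub-universe (relative form) -/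

/-- **Flag count, relative to `V`.** For `k ≤ n₁`: `C(#V-k, n₁-k) · Σ_{A ⊆ V} F(A) ≤ Σ_{V₁ ⊆ V} Σ_{A ⊆ V₁} F(A)`
over `k`-subsets `A` and `n₁`-subsets `V₁`. [folklore] -/
theorem sum_powersetCard_flag_le_of (V : Finset (Fin n)) (k n₁ : ℕ) (hk : k ≤ n₁) (F : Finset (Fin n) → ℕ) :
    (#V - k).choose (n₁ - k) * ∑ A ∈ powersetCard k V, F A ≤
      ∑ V₁ ∈ powersetCard n₁ V, ∑ A ∈ powersetCard k V₁, F A := by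
  classical
  have hrhs : ∑ V₁ ∈ powersetCard n₁ V, ∑ A ∈ powersetCard k V₁, F A =
      ∑ A ∈ powersetCard k V, #((powersetCard n₁ V).filter fun V₁ => A ⊆ V₁) * F A := by
    have h1 : ∀ V₁ ∈ powersetCard n₁ V, ∑ A ∈ powersetCard k V₁, F A =
        ∑ A ∈ powersetCard k V, if A ⊆ V₁ then F A else 0 := by
      intro V₁ hV₁
      rw [mem_powersetCard] at hV₁
      rw [← sum_filter]
      congr 1
      ext A
      simp only [mem_powersetCard, mem_filter]
      constructor
      · rintro ⟨hAV₁, hcard⟩; exact ⟨⟨hAV₁.trans hV₁.1, hcard⟩, hAV₁⟩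
      · rintro ⟨⟨-, hcard⟩, hAV₁⟩; exact ⟨hAV₁, hcard⟩
    rw [sum_congr rfl h1, sum_comm]
    refine sum_congr rfl fun A _ => ?_
    rw [← sum_filter, sum_const, smul_eq_mul]
  rw [hrhs, mul_sum]
  refine sum_le_sum fun A hA => Nat.mul_le_mul_right _ ?_
  rw [mem_powersetCard] at hA
  calc (#V - k).choose (n₁ - k) = #(powersetCard (n₁ - k) (V \ A)) := by
        rw [card_powersetCard, card_sdiff_of_subset hA.1, hA.2]
    _ ≤ #((powersetCard n₁ V).filter fun V₁ => A ⊆ V₁) := by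
        refine card_le_card_of_injOn (fun W => W ∪ A) (fun W hW => ?_) ?_
        · rw [mem_coe, mem_powersetCard] at hW
          rw [mem_coe, mem_filter, mem_powersetCard]
          have hdisj : Disjoint W A := Finset.disjoint_left.2 fun v hvW hvA => (mem_sdiff.1 (hW.1 hvW)).2 hvA
          refine ⟨⟨union_subset (hW.1.trans sdiff_subset) hA.1, ?_⟩, subset_union_right⟩
          rw [card_union_of_disjoint hdisj, hW.2, hA.2]
          omega
        · intro W hW W' hW' h
          rw [mem_coe, mem_powersetCard] at hW hW'
          have hdW : Disjoint W A := Finset.disjoint_left.2 fun v hvW hvA => (mem_sdiff.1 (hW.1 hvW)).2 hvA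
          have hdW' : Disjoint W' A := Finset.disjoint_left.2 fun v hvW hvA => (mem_sdiff.1 (hW'.1 hvW)).2 hvA
          simp only at h
          rw [← union_sdiff_cancel_right hdW, ← union_sdiff_cancel_right hdW', h]

/-! ### The base: a CNF with narrow clauses -/

/-- A level-`1` formula read as a CNF (clause form). [folklore] -/
theorem swEval_one_false' (c : swForm n 1) (w : EdgeVec n) :
    swEval 1 false c w ↔ ∀ S ∈ c.clauses, ∃ e ∈ S, w e = true := Iff.rfl

/-- Cross-multiplication: `p ≤ q · (a / b)` in `ℝ≥0∞` from `p b ≤ q a` in `ℕ`. [folklore] -/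
theorem natCast_le_mul_div_of_mul_le {p q a b : ℕ} (h : p * b ≤ q * a) (hb : b ≠ 0) :
    ((p : ℕ) : ℝ≥0∞) ≤ ((q : ℕ) : ℝ≥0∞) * (((a : ℕ) : ℝ≥0∞) / ((b : ℕ) : ℝ≥0∞)) := by
  have hb' : ((b : ℕ) : ℝ≥0∞) ≠ 0 := by exact_mod_cast hb
  have hbt : ((b : ℕ) : ℝ≥0∞) ≠ ⊤ := ENNReal.natCast_ne_top _
  rw [← mul_div_assoc, ENNReal.le_div_iff_mul_le (Or.inl hb') (Or.inl hbt)]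
  exact_mod_cast h

open Classical in
/-- **Base of the depth reduction (count form)**: for a CNF `f` with clauses of `≤ L` slots and `2 ≤ k ≤ #V`,
`Σ_{A ⊆ V, #A = k} #{x : f(x ∨ K_A) ∧ ¬ f x} ≤ C(#V,k) · 2^N · (L k² / (#V)²)`. [folklore] -/
theorem swIter_base (V : Finset (Fin n)) (f : swForm n 1) (M L k : ℕ) (hf : swBnd M L 1 f) (hk2 : 2 ≤ k) (hk : k ≤ #V) :
    ((∑ A ∈ powersetCard k V, #(univ.filter fun x : EdgeVec n =>
        swEval 1 false f (plant A x) ∧ ¬ swEval 1 false f x) : ℕ) : ℝ≥0∞) ≤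
      (((#V).choose k : ℕ) : ℝ≥0∞) * (((2 ^ Fintype.card (⊤ : SimpleGraph (Fin n)).edgeSet : ℕ) : ℝ≥0∞)) *
        (((L * k ^ 2 : ℕ) : ℝ≥0∞) / (((#V) ^ 2 : ℕ) : ℝ≥0∞)) := by
  -- the revival count
  have hL : ∀ S ∈ f.clauses.toFinset, #S ≤ L := fun S hS => ((swBnd_one M L f).1 hf).2 S (List.mem_toFinset.1 hS)
  have hcount := narrowCnf_revival_count V k L (fun _ => f.clauses.toFinset) fun _ S hS => hL S hS
  have hcount' : ∑ A ∈ powersetCard k V, #(univ.filter fun x : EdgeVec n =>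
      swEval 1 false f (plant A x) ∧ ¬ swEval 1 false f x) ≤
      2 ^ Fintype.card (⊤ : SimpleGraph (Fin n)).edgeSet * (L * (#V - 2).choose (k - 2)) := by
    refine le_of_eq_of_le (sum_congr rfl fun A _ => ?_) hcount
    congr 1
    ext x
    simp only [mem_filter, swEval_one_false', List.mem_toFinset]
  rw [← Nat.cast_mul]
  refine natCast_le_mul_div_of_mul_le ?_ (pow_pos (by omega) 2).ne'
  have h := choose_sub_mul_pow_le (#V) k 2 hk2 hk
  calc (∑ A ∈ powersetCard k V, #(univ.filter fun x : EdgeVec n =>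
        swEval 1 false f (plant A x) ∧ ¬ swEval 1 false f x)) * #V ^ 2
      ≤ 2 ^ Fintype.card (⊤ : SimpleGraph (Fin n)).edgeSet * (L * (#V - 2).choose (k - 2)) * #V ^ 2 :=
        Nat.mul_le_mul_right _ hcount'
    _ = 2 ^ Fintype.card (⊤ : SimpleGraph (Fin n)).edgeSet * L * ((#V - 2).choose (k - 2) * #V ^ 2) := by ring
    _ ≤ 2 ^ Fintype.card (⊤ : SimpleGraph (Fin n)).edgeSet * L * ((#V).choose k * k ^ 2) := Nat.mul_le_mul_left _ h
    _ = (#V).choose k * 2 ^ Fintype.card (⊤ : SimpleGraph (Fin n)).edgeSet * (L * k ^ 2) := by ring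

/-! ### The step: one switching -/

/-- Planting inside `V₁` does not change the input off the inside of `V₁`. [folklore] -/
theorem plant_eq_of_not_inside {V₁ A : Finset (Fin n)} (hA : A ⊆ V₁) (x : EdgeVec n)
    (e : (⊤ : SimpleGraph (Fin n)).edgeSet) (he : ¬ ∀ v ∈ (e : Sym2 (Fin n)), v ∈ V₁) : plant A x e = x e :=
  plant_apply_of_not_inside A x e fun heA => he fun v hv => hA (heA v hv)

/-- Planting commutes with changing the input off the inside. [folklore] -/
theorem plant_congr_inside (V₁ A : Finset (Fin n)) {x x' : EdgeVec n}
    (h : ∀ e : (⊤ : SimpleGraph (Fin n)).edgeSet, (∀ v ∈ (e : Sym2 (Fin n)), v ∈ V₁) → x e = x' e)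
    (e : (⊤ : SimpleGraph (Fin n)).edgeSet) (he : ∀ v ∈ (e : Sym2 (Fin n)), v ∈ V₁) : plant A x e = plant A x' e := by
  classical
  simp only [plant, h e he]

open Classical in
/-- **One input, one sub-universe.** For `A ⊆ V₁`: if `f(x ∨ K_A) ∧ ¬ f x` then either the switching is bad at `x`
w.r.t. `V₁`, or it is good at the erased input and the REDUCED formula (w.r.t. the erased input) separates
`x ∨ K_A` from `x`. [folklore] -/
theorem swIter_pointwise (V₁ A : Finset (Fin n)) (hA : A ⊆ V₁) (v₀ d : ℕ) (f : swForm n (d + 2)) (x : EdgeVec n)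
    (h : swEval (d + 2) false f (plant A x) ∧ ¬ swEval (d + 2) false f x) :
    swBadAt V₁ x v₀ (d + 1) false f ∨
      (¬ swBadAt V₁ (swErase V₁ x) v₀ (d + 1) false f ∧
        (swEval (d + 1) false (swReduce V₁ (swErase V₁ x) d false f) (plant A x) ∧
          ¬ swEval (d + 1) false (swReduce V₁ (swErase V₁ x) d false f) x)) := by
  by_cases hbad : swBadAt V₁ x v₀ (d + 1) false f
  · exact Or.inl hbad
  refine Or.inr ⟨?_, ?_⟩
  · rwa [swBadAt_congr_outside V₁ v₀ (d + 1) false f fun e he => (swErase_of_not_inside V₁ x he).symm]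
  · rw [swReduce_congr_outside V₁ (fun e he => (swErase_of_not_inside V₁ x he).symm) d false f,
      ← swEval_swReduce V₁ x (plant A x) (fun e he => plant_eq_of_not_inside hA x e he) d false f,
      ← swEval_swReduce V₁ x x (fun _ _ => rfl) d false f]
    exact h

open Classical in
/-- **One sub-universe, summed over the planted sets.** [folklore] -/
theorem swIter_oneV₁ (V₁ : Finset (Fin n)) (k v₀ d : ℕ) (f : swForm n (d + 2)) :
    ∑ A ∈ powersetCard k V₁, #(univ.filter fun x : EdgeVec n =>
        swEval (d + 2) false f (plant A x) ∧ ¬ swEval (d + 2) false f x) ≤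
      (#V₁).choose k * #(univ.filter fun x : EdgeVec n => swBadAt V₁ x v₀ (d + 1) false f) +
        ∑ A ∈ powersetCard k V₁, #(univ.filter fun x : EdgeVec n =>
          ¬ swBadAt V₁ (swErase V₁ x) v₀ (d + 1) false f ∧
            (swEval (d + 1) false (swReduce V₁ (swErase V₁ x) d false f) (plant A x) ∧
              ¬ swEval (d + 1) false (swReduce V₁ (swErase V₁ x) d false f) x)) := by
  rw [← card_powersetCard k V₁, card_eq_sum_ones (powersetCard k V₁), sum_mul, one_mul, ← sum_add_distrib]
  refine sum_le_sum fun A hA => ?_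
  have hAV₁ : A ⊆ V₁ := (mem_powersetCard.1 hA).1
  refine (card_le_card fun x hx => ?_).trans (card_union_le _ _)
  rw [mem_filter] at hx
  rw [mem_union, mem_filter, mem_filter]
  rcases swIter_pointwise V₁ A hAV₁ v₀ d f x hx.2 with h | h
  · exact Or.inl ⟨mem_univ _, h⟩
  · exact Or.inr ⟨mem_univ _, h⟩

/-! ### The iteration -/

open Classical in
/-- **The depth reduction, count form.** For a level-`(d+1)` formula `f` (top gate AND) inside `V` with bounds
`(M, L)` and admissible sizes `ms` (`|ms| = d`):
`Σ_{A ⊆ V, #A = k} #{x : f(x ∨ K_A) ∧ ¬ f x} ≤ C(#V,k) · 2^N · swErr v₀ k (#V) ms M L`. [folklore] -/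
theorem swIter_count_le (v₀ k : ℕ) (hv₀ : 0 < v₀) :
    ∀ (d : ℕ) (ms : List ℕ), ms.length = d → ∀ (V : Finset (Fin n)) (f : swForm n (d + 1)) (M L : ℕ),
      swIn V (d + 1) f → swBnd M L (d + 1) f → swSizeOK v₀ k (#V) ms →
      ((∑ A ∈ powersetCard k V, #(univ.filter fun x : EdgeVec n =>
          swEval (d + 1) false f (plant A x) ∧ ¬ swEval (d + 1) false f x) : ℕ) : ℝ≥0∞) ≤
        (((#V).choose k : ℕ) : ℝ≥0∞) * (((2 ^ Fintype.card (⊤ : SimpleGraph (Fin n)).edgeSet : ℕ) : ℝ≥0∞)) *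
          swErr v₀ k (#V) ms M L := by
  intro d
  induction d with
  | zero =>
    intro ms hms V f M L _ hf hsz
    obtain rfl : ms = [] := List.eq_nil_of_length_eq_zero hms
    exact swIter_base V f M L k hf hsz.1 hsz.2
  | succ d ih =>
    intro ms hms V f M L hfin hf hsz
    obtain ⟨m₁, ms, rfl⟩ : ∃ m₁ ms', ms = m₁ :: ms' := by
      cases ms with
      | nil => exact absurd hms (by simp)
      | cons m₁ ms' => exact ⟨m₁, ms', rfl⟩
    have hd : ms.length = d := by simpa using hms
    obtain ⟨hv₀m₁, hm₁m, hsz'⟩ := hsz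
    obtain ⟨hk2, hkm₁⟩ := k_le_of_swSizeOK v₀ k ms m₁ hsz'
    simp only [swErr, swT, hd]
    -- abbreviations
    set r := (v₀ - 1).choose 2 with hr
    set T := 2 ^ (r + r) * (2 * (L + 1) ^ (2 * r)) ^ (r + 1) + M * (2 * L).choose v₀ with hT
    have hkm : k ≤ #V := hkm₁.trans hm₁m
    -- (1) one sub-universe: bad event + induction hypothesis on the worst outside part
    have hP : ∀ (V₁ : Finset (Fin n)) (ξ : EdgeVec n) (A : Finset (Fin n)) (x x' : EdgeVec n),
        (∀ e : (⊤ : SimpleGraph (Fin n)).edgeSet, (∀ v ∈ (e : Sym2 (Fin n)), v ∈ V₁) → x e = x' e) →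
        ((swEval (d + 1) false (swReduce V₁ ξ d false f) (plant A x) ∧
            ¬ swEval (d + 1) false (swReduce V₁ ξ d false f) x) ↔
          (swEval (d + 1) false (swReduce V₁ ξ d false f) (plant A x') ∧
            ¬ swEval (d + 1) false (swReduce V₁ ξ d false f) x')) := by
      intro V₁ ξ A x x' h
      have hg := swIn_swReduce V₁ ξ d false f
      rw [swEval_congr_inside V₁ (fun e he => plant_congr_inside V₁ A h e he) (d + 1) false _ hg,
        swEval_congr_inside V₁ h (d + 1) false _ hg]
    have hone : ∀ V₁ ∈ powersetCard m₁ V,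
        ((∑ A ∈ powersetCard k V₁, #(univ.filter fun x : EdgeVec n =>
            swEval (d + 2) false f (plant A x) ∧ ¬ swEval (d + 2) false f x) : ℕ) : ℝ≥0∞) ≤
          ((m₁.choose k * #(univ.filter fun x : EdgeVec n => swBadAt V₁ x v₀ (d + 1) false f) : ℕ) : ℝ≥0∞) +
            ((m₁.choose k : ℕ) : ℝ≥0∞) * (((2 ^ Fintype.card (⊤ : SimpleGraph (Fin n)).edgeSet : ℕ) : ℝ≥0∞)) *
              swErr v₀ k m₁ ms (M * 2 ^ r) r := by
      intro V₁ hV₁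
      have hcard : #V₁ = m₁ := (mem_powersetCard.1 hV₁).2
      have h1 := swIter_oneV₁ V₁ k v₀ d f
      rw [hcard] at h1
      rcases exists_outside_max V₁ (powersetCard k V₁) (fun ξ => ¬ swBadAt V₁ ξ v₀ (d + 1) false f)
          (fun ξ A x => swEval (d + 1) false (swReduce V₁ ξ d false f) (plant A x) ∧
            ¬ swEval (d + 1) false (swReduce V₁ ξ d false f) x) (fun ξ A x x' h => hP V₁ ξ A x x' h)
        with h0 | ⟨ξ, hG, -, hle⟩
      · have h2 : ∑ A ∈ powersetCard k V₁, #(univ.filter fun x : EdgeVec n =>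
            ¬ swBadAt V₁ (swErase V₁ x) v₀ (d + 1) false f ∧
              (swEval (d + 1) false (swReduce V₁ (swErase V₁ x) d false f) (plant A x) ∧
                ¬ swEval (d + 1) false (swReduce V₁ (swErase V₁ x) d false f) x)) = 0 := by
          rw [← h0]
          refine sum_congr rfl fun A _ => ?_
          congr 1
          ext x
          simp only [mem_filter]
        rw [h2, add_zero] at h1
        calc _ ≤ ((m₁.choose k * #(univ.filter fun x : EdgeVec n => swBadAt V₁ x v₀ (d + 1) false f) : ℕ) : ℝ≥0∞) := by
              exact_mod_cast h1
          _ ≤ _ := le_self_add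
      · -- the induction hypothesis for the reduced formula at the worst outside part `ξ`
        have hgood := good_of_not_swBadAt hG
        have hg_in := swIn_swReduce V₁ ξ d false f
        have hg_bnd := swBnd_swReduce V₁ ξ M L v₀ d false f hf hgood
        have hsz₁ : swSizeOK v₀ k (#V₁) ms := by rw [hcard]; exact hsz'
        have hIH := ih ms hd V₁ (swReduce V₁ ξ d false f) (M * 2 ^ r) r hg_in hg_bnd hsz₁
        rw [hcard] at hIH
        have h3 : ∑ A ∈ powersetCard k V₁, #(univ.filter fun x : EdgeVec n =>
            ¬ swBadAt V₁ (swErase V₁ x) v₀ (d + 1) false f ∧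
              (swEval (d + 1) false (swReduce V₁ (swErase V₁ x) d false f) (plant A x) ∧
                ¬ swEval (d + 1) false (swReduce V₁ (swErase V₁ x) d false f) x)) ≤
            ∑ A ∈ powersetCard k V₁, #(univ.filter fun x : EdgeVec n =>
              swEval (d + 1) false (swReduce V₁ ξ d false f) (plant A x) ∧
                ¬ swEval (d + 1) false (swReduce V₁ ξ d false f) x) := by
          refine (le_of_eq (sum_congr rfl fun A _ => ?_)).trans (hle.trans (le_of_eq (sum_congr rfl fun A _ => ?_)))
          · congr 1
            ext x
            simp only [mem_filter]
          · congr 1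
            ext x
            simp only [mem_filter]
        calc _ ≤ ((m₁.choose k * #(univ.filter fun x : EdgeVec n => swBadAt V₁ x v₀ (d + 1) false f) +
              ∑ A ∈ powersetCard k V₁, #(univ.filter fun x : EdgeVec n =>
                swEval (d + 1) false (swReduce V₁ ξ d false f) (plant A x) ∧
                  ¬ swEval (d + 1) false (swReduce V₁ ξ d false f) x) : ℕ) : ℝ≥0∞) := by
              exact_mod_cast h1.trans (Nat.add_le_add_left h3 _)
          _ ≤ _ := by rw [Nat.cast_add]; exact add_le_add le_rfl hIH
    -- (2) sum over the sub-universes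
    have hflag := sum_powersetCard_flag_le_of V k m₁ hkm₁ fun A => #(univ.filter fun x : EdgeVec n =>
      swEval (d + 2) false f (plant A x) ∧ ¬ swEval (d + 2) false f x)
    have hbad := swReduce_bad_count V m₁ M L v₀ hv₀ d false f hf
    rw [← hr, ← hT] at hbad
    have hsumV₁ : (((#V - k).choose (m₁ - k) : ℕ) : ℝ≥0∞) *
        ((∑ A ∈ powersetCard k V, #(univ.filter fun x : EdgeVec n =>
          swEval (d + 2) false f (plant A x) ∧ ¬ swEval (d + 2) false f x) : ℕ) : ℝ≥0∞) ≤
        ((m₁.choose k * (M ^ (d + 1) * (2 ^ Fintype.card (⊤ : SimpleGraph (Fin n)).edgeSet *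
            (#V - v₀).choose (m₁ - v₀) * T)) : ℕ) : ℝ≥0∞) +
          (((#V).choose m₁ : ℕ) : ℝ≥0∞) * (((m₁.choose k : ℕ) : ℝ≥0∞) *
            (((2 ^ Fintype.card (⊤ : SimpleGraph (Fin n)).edgeSet : ℕ) : ℝ≥0∞)) * swErr v₀ k m₁ ms (M * 2 ^ r) r) := by
      calc (((#V - k).choose (m₁ - k) : ℕ) : ℝ≥0∞) *
            ((∑ A ∈ powersetCard k V, #(univ.filter fun x : EdgeVec n =>
              swEval (d + 2) false f (plant A x) ∧ ¬ swEval (d + 2) false f x) : ℕ) : ℝ≥0∞)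
          ≤ ((∑ V₁ ∈ powersetCard m₁ V, ∑ A ∈ powersetCard k V₁, #(univ.filter fun x : EdgeVec n =>
              swEval (d + 2) false f (plant A x) ∧ ¬ swEval (d + 2) false f x) : ℕ) : ℝ≥0∞) := by
            exact_mod_cast hflag
        _ = ∑ V₁ ∈ powersetCard m₁ V, ((∑ A ∈ powersetCard k V₁, #(univ.filter fun x : EdgeVec n =>
              swEval (d + 2) false f (plant A x) ∧ ¬ swEval (d + 2) false f x) : ℕ) : ℝ≥0∞) := by
            rw [Nat.cast_sum]
        _ ≤ ∑ V₁ ∈ powersetCard m₁ V,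
              (((m₁.choose k * #(univ.filter fun x : EdgeVec n => swBadAt V₁ x v₀ (d + 1) false f) : ℕ) : ℝ≥0∞) +
                ((m₁.choose k : ℕ) : ℝ≥0∞) * (((2 ^ Fintype.card (⊤ : SimpleGraph (Fin n)).edgeSet : ℕ) : ℝ≥0∞)) *
                  swErr v₀ k m₁ ms (M * 2 ^ r) r) := sum_le_sum hone
        _ = ((m₁.choose k * ∑ V₁ ∈ powersetCard m₁ V,
                #(univ.filter fun x : EdgeVec n => swBadAt V₁ x v₀ (d + 1) false f) : ℕ) : ℝ≥0∞) +
              (((#V).choose m₁ : ℕ) : ℝ≥0∞) * (((m₁.choose k : ℕ) : ℝ≥0∞) *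
                (((2 ^ Fintype.card (⊤ : SimpleGraph (Fin n)).edgeSet : ℕ) : ℝ≥0∞)) * swErr v₀ k m₁ ms (M * 2 ^ r) r) := by
            rw [sum_add_distrib, sum_const, card_powersetCard, nsmul_eq_mul, mul_sum, Nat.cast_sum]
        _ ≤ _ := add_le_add (by exact_mod_cast Nat.mul_le_mul_left _ hbad) le_rfl
    -- (3) the algebra: divide by `C(#V-k, m₁-k)`
    have hC₁pos : 0 < (#V - k).choose (m₁ - k) := Nat.choose_pos (by omega)
    have hC₁ : (((#V - k).choose (m₁ - k) : ℕ) : ℝ≥0∞) ≠ 0 := by exact_mod_cast hC₁pos.ne'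
    have hchoose : (#V).choose m₁ * m₁.choose k = (#V).choose k * (#V - k).choose (m₁ - k) :=
      Nat.choose_mul (n := #V) hkm₁
    have hmpos : 0 < #V := by omega
    have hi : ((m₁.choose k * (M ^ (d + 1) * (2 ^ Fintype.card (⊤ : SimpleGraph (Fin n)).edgeSet *
        (#V - v₀).choose (m₁ - v₀) * T)) : ℕ) : ℝ≥0∞) ≤
        ((((#V - k).choose (m₁ - k) * ((#V).choose k * 2 ^ Fintype.card (⊤ : SimpleGraph (Fin n)).edgeSet) : ℕ)) :
            ℝ≥0∞) *
          (((M ^ (d + 1) * T * m₁ ^ v₀ : ℕ) : ℝ≥0∞) / ((#V ^ v₀ : ℕ) : ℝ≥0∞)) := by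
      refine natCast_le_mul_div_of_mul_le ?_ (pow_pos hmpos _).ne'
      have key := choose_sub_mul_pow_le (#V) m₁ v₀ hv₀m₁ hm₁m
      calc m₁.choose k * (M ^ (d + 1) * (2 ^ Fintype.card (⊤ : SimpleGraph (Fin n)).edgeSet *
            (#V - v₀).choose (m₁ - v₀) * T)) * #V ^ v₀
          = m₁.choose k * M ^ (d + 1) * 2 ^ Fintype.card (⊤ : SimpleGraph (Fin n)).edgeSet * T *
              ((#V - v₀).choose (m₁ - v₀) * #V ^ v₀) := by ring
        _ ≤ m₁.choose k * M ^ (d + 1) * 2 ^ Fintype.card (⊤ : SimpleGraph (Fin n)).edgeSet * T *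
              ((#V).choose m₁ * m₁ ^ v₀) := Nat.mul_le_mul_left _ key
        _ = ((#V).choose m₁ * m₁.choose k) * 2 ^ Fintype.card (⊤ : SimpleGraph (Fin n)).edgeSet *
              (M ^ (d + 1) * T * m₁ ^ v₀) := by ring
        _ = _ := by rw [hchoose]; ring
    have hii : (((#V).choose m₁ : ℕ) : ℝ≥0∞) * (((m₁.choose k : ℕ) : ℝ≥0∞) *
        (((2 ^ Fintype.card (⊤ : SimpleGraph (Fin n)).edgeSet : ℕ) : ℝ≥0∞)) * swErr v₀ k m₁ ms (M * 2 ^ r) r) =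
        ((((#V - k).choose (m₁ - k) * ((#V).choose k * 2 ^ Fintype.card (⊤ : SimpleGraph (Fin n)).edgeSet) : ℕ)) :
            ℝ≥0∞) * swErr v₀ k m₁ ms (M * 2 ^ r) r := by
      calc (((#V).choose m₁ : ℕ) : ℝ≥0∞) * (((m₁.choose k : ℕ) : ℝ≥0∞) *
            (((2 ^ Fintype.card (⊤ : SimpleGraph (Fin n)).edgeSet : ℕ) : ℝ≥0∞)) * swErr v₀ k m₁ ms (M * 2 ^ r) r)
          = ((((#V).choose m₁ * m₁.choose k : ℕ)) : ℝ≥0∞) *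
              (((2 ^ Fintype.card (⊤ : SimpleGraph (Fin n)).edgeSet : ℕ) : ℝ≥0∞)) * swErr v₀ k m₁ ms (M * 2 ^ r) r := by
            push_cast; ring
        _ = _ := by rw [hchoose]; push_cast; ring
    rw [← ENNReal.mul_le_mul_iff_right hC₁ (ENNReal.natCast_ne_top _)]
    refine hsumV₁.trans ?_
    rw [hii]
    refine (add_le_add hi le_rfl).trans (le_of_eq ?_)
    push_cast
    ring

/-- Registered stub `stub_formIter` of the AC⁰ line, stage C (side result of stmt-PneNP-18027, seat 0). [folklore] -/
theorem stub_formIter : ∀ p q a b : ℕ, p * b ≤ q * a → b ≠ 0 → ((p : ℕ) : ENNReal) ≤ ((q : ℕ) : ENNReal) * (((a : ℕ) : ENNReal) / ((b : ℕ) : ENNReal)) := 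
  fun _ _ _ _ h hb => natCast_le_mul_div_of_mul_le h hb

end Summit.PneNP.PneNP.Theorems
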